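import Mathlib.Analysis.Calculus.FDeriv.Partial
import Mathlib.Analysis.Calculus.Deriv.Comp
import Mathlib.Analysis.Calculus.Deriv.Shift
import Mathlib.MeasureTheory.Integral.IntervalIntegral.FundThmCalculus
import Literature.Topology.Euclidean.PlanarStaircase
import HarnessLib

/-!
# A planar function whose increments along two directions are line integrals of a continuous field is differentiable

Topic `Literature/Analysis/Calculus`, namespace `Literature.Analysis.Calculus`.
Let `V ⊆ ℂ` be open, `G : ℂ → ℂ` continuous on `V`, and `p : ℂ → ℝ` such that, at every point
`z ∈ V` and for each of the four directions `±u₁, ±u₂` (`u₁, u₂` independent), for small `t ≥ 0`,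

  `p(z + t u) - p(z) = ∫_0^t Re(G(z + s u) u) ds`.

Then `p` is (real-)differentiable on `V` with derivative `h ↦ Re(G(z) h)` (`hasFDerivAt_of_lineIntegral`):
the partial derivatives along `u₁, u₂` exist (`Re(G u₁)`, `Re(G u₂)`, fundamental theorem of calculus)
and are continuous, hence `p` is strictly differentiable (Mathlib's `hasStrictFDerivAt_uncurry_coprod`).
This is the regularity of the primitive of the exact form `ℒ_{Ω,k+1} = ∑_j Re[𝒜_Ω da_j]` of
Chelkak–Hongler–Izyurov (2015), §2.8, needed to integrate the covariance rule of `𝒜_Ω` along curved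
paths (Remark 2.21).

## References

* W. Rudin, *Principles of Mathematical Analysis*, 3rd ed., Thm. 9.21 (continuous partials imply
  differentiability) [folklore].
* D. Chelkak, C. Hongler, K. Izyurov, Ann. of Math. 181 (2015), §2.8 and Remark 2.21
  [ChelkakHonglerIzyurovAnnals2015].
-/

noncomputable section

open Set Filter Topology MeasureTheory intervalIntegral
open Literature.Topology.Euclidean

namespace Literature.Analysis.Calculus

/-- The real-linear functional `h ↦ Re(w h)` on `ℂ`. [folklore] -/
def reMulCLM (w : ℂ) : ℂ →L[ℝ] ℝ :=
  w.re • Complex.reCLM - w.im • Complex.imCLM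

/-- `reMulCLM w h = Re(w h)`. [folklore] -/
@[simp] theorem reMulCLM_apply (w h : ℂ) : reMulCLM w h = (w * h).re := by
  simp [reMulCLM, Complex.mul_re]

/-- The coordinate functionals of the basis `u₁, u₂`: `h ↦ ((h × u₂)/(u₁ × u₂), (u₁ × h)/(u₁ × u₂))`.
[folklore] -/
def crossCoords (u₁ u₂ : ℂ) : ℂ →L[ℝ] ℝ × ℝ :=
  ((cross u₁ u₂)⁻¹ • (u₂.im • Complex.reCLM - u₂.re • Complex.imCLM)).prod
    ((cross u₁ u₂)⁻¹ • (u₁.re • Complex.imCLM - u₁.im • Complex.reCLM))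

/-- The coordinates recover the vector: `h = s u₁ + t u₂`. [folklore] -/
theorem crossCoords_decomp {u₁ u₂ : ℂ} (h0 : cross u₁ u₂ ≠ 0) (h : ℂ) :
    h = ((crossCoords u₁ u₂ h).1 : ℂ) * u₁ + ((crossCoords u₁ u₂ h).2 : ℂ) * u₂ := by
  have h1 : (crossCoords u₁ u₂ h).1 = cross h u₂ / cross u₁ u₂ := by
    simp [crossCoords, cross]; ring
  have h2 : (crossCoords u₁ u₂ h).2 = cross u₁ h / cross u₁ u₂ := by
    simp [crossCoords, cross]; ring
  rw [h1, h2]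
  exact eq_cross_div_mul_add h0 h

variable {V : Set ℂ} {p : ℂ → ℝ} {G : ℂ → ℂ}

/-- **Two-sided integral formula along a line.** If the one-sided formula holds at `z` for `u` and
for `-u`, then `p(z + t u) - p(z) = ∫_0^t Re(G(z + s u) u) ds` for all `t` in a neighbourhood of `0`.
[folklore] -/
theorem eventually_sub_eq_integral {z u : ℂ}
    (hp : ∃ τ > 0, ∀ t : ℝ, t ∈ Icc (0 : ℝ) τ →
      p (z + (t : ℂ) * u) - p z = ∫ s in (0 : ℝ)..t, (G (z + (s : ℂ) * u) * u).re)
    (hn : ∃ τ > 0, ∀ t : ℝ, t ∈ Icc (0 : ℝ) τ →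
      p (z + (t : ℂ) * (-u)) - p z = ∫ s in (0 : ℝ)..t, (G (z + (s : ℂ) * (-u)) * (-u)).re) :
    ∀ᶠ t : ℝ in 𝓝 (0 : ℝ), p (z + (t : ℂ) * u) - p z = ∫ s in (0 : ℝ)..t, (G (z + (s : ℂ) * u) * u).re := by
  obtain ⟨τ₁, hτ₁, h₁⟩ := hp
  obtain ⟨τ₂, hτ₂, h₂⟩ := hn
  have hmem : Ioo (-τ₂) τ₁ ∈ 𝓝 (0 : ℝ) := Ioo_mem_nhds (by linarith) hτ₁
  filter_upwards [hmem] with t ht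
  rcases le_or_gt 0 t with ht0 | ht0
  · exact h₁ t ⟨ht0, ht.2.le⟩
  · have h := h₂ (-t) ⟨by linarith, by linarith [ht.1]⟩
    have e1 : z + ((-t : ℝ) : ℂ) * (-u) = z + (t : ℂ) * u := by push_cast; ring
    rw [e1] at h
    rw [h]
    have hcomp := intervalIntegral.integral_comp_neg (a := (0 : ℝ)) (b := -t)
      (fun σ : ℝ => (G (z + (σ : ℂ) * u) * u).re)
    beta_reduce at hcomp
    have e2 : ∀ s : ℝ, (G (z + (s : ℂ) * (-u)) * (-u)).re = -((G (z + ((-s : ℝ) : ℂ) * u) * u).re) := by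
      intro s
      simp only [mul_neg, Complex.neg_re]
      congr 3
      push_cast; ring
    simp_rw [e2]
    rw [intervalIntegral.integral_neg, hcomp, neg_neg, neg_zero, intervalIntegral.integral_symm, neg_neg]

/-- **The derivative along a line at the base point**: under the two-sided integral formula near `0`
and continuity of `G` at `z ∈ V` (open), `t ↦ p(z + t u)` has derivative `Re(G(z) u)` at `0`.
[folklore] -/
theorem hasDerivAt_line (hV : IsOpen V) (hG : ContinuousOn G V) {z u : ℂ} (hz : z ∈ V)
    (h : ∀ᶠ t : ℝ in 𝓝 (0 : ℝ), p (z + (t : ℂ) * u) - p z = ∫ s in (0 : ℝ)..t, (G (z + (s : ℂ) * u) * u).re) :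
    HasDerivAt (fun t : ℝ => p (z + (t : ℂ) * u)) ((G z * u).re) 0 := by
  -- the integrand is continuous near `0`
  set F : ℝ → ℝ := fun s => (G (z + s * u) * u).re with hF
  have hline : Continuous fun s : ℝ => z + (s : ℂ) * u :=
    continuous_const.add (Complex.continuous_ofReal.mul continuous_const)
  set W : Set ℝ := (fun s : ℝ => z + (s : ℂ) * u) ⁻¹' V with hW
  have hWo : IsOpen W := hV.preimage hline
  have h0W : (0 : ℝ) ∈ W := by simp [hW, hz]
  have hFc : ContinuousOn F W := by
    refine Complex.continuous_re.comp_continuousOn ((hG.comp hline.continuousOn fun s hs => hs).mul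
      continuousOn_const)
  have hF0 : ContinuousAt F 0 := hFc.continuousAt (hWo.mem_nhds h0W)
  have hmeas : StronglyMeasurableAtFilter F (𝓝 0) volume :=
    ContinuousOn.stronglyMeasurableAtFilter hWo hFc 0 h0W
  have hint : HasDerivAt (fun t => ∫ s in (0 : ℝ)..t, F s) (F 0) 0 :=
    intervalIntegral.integral_hasDerivAt_right (IntervalIntegrable.refl (a := 0)) hmeas hF0
  have hF0v : F 0 = (G z * u).re := by simp [hF]
  rw [← hF0v]
  -- `p (z + t u) = p z + ∫_0^t F` near `0`
  have heq : (fun t : ℝ => p (z + t * u)) =ᶠ[𝓝 0] fun t => p z + ∫ s in (0 : ℝ)..t, F s := by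
    filter_upwards [h] with t ht
    simp only [hF]
    linarith
  refine HasDerivAt.congr_of_eventuallyEq ?_ heq
  simpa using hint.const_add (p z)

/-- **Continuous line-primitives are differentiable.** Let `V ⊆ ℂ` be open, `G` continuous on `V`,
`u₁ × u₂ ≠ 0`, and suppose that at every `z ∈ V`, for each direction `u ∈ {u₁, -u₁, u₂, -u₂}` and all
small `t ≥ 0`, `p(z + tu) - p(z) = ∫_0^t Re(G(z + su) u) ds`. Then `p` has the Fréchet derivative
`h ↦ Re(G(z) h)` at every `z ∈ V`. [folklore] -/
theorem hasFDerivAt_of_lineIntegral (hV : IsOpen V) (hG : ContinuousOn G V) {u₁ u₂ : ℂ}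
    (hind : cross u₁ u₂ ≠ 0)
    (hint : ∀ z ∈ V, ∀ u ∈ ({u₁, -u₁, u₂, -u₂} : Set ℂ), ∃ τ > 0, ∀ t : ℝ, t ∈ Icc (0 : ℝ) τ →
      p (z + (t : ℂ) * u) - p z = ∫ s in (0 : ℝ)..t, (G (z + (s : ℂ) * u) * u).re)
    {z : ℂ} (hz : z ∈ V) : HasFDerivAt p (reMulCLM (G z)) z := by
  -- line derivatives at every point of `V`, in the directions `u₁` and `u₂`
  have hline : ∀ w ∈ V, ∀ u ∈ ({u₁, u₂} : Set ℂ),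
      HasDerivAt (fun t : ℝ => p (w + (t : ℂ) * u)) ((G w * u).re) 0 := by
    intro w hw u hu
    have hu' : u ∈ ({u₁, -u₁, u₂, -u₂} : Set ℂ) := by
      rcases hu with rfl | rfl <;> simp
    have hnu' : -u ∈ ({u₁, -u₁, u₂, -u₂} : Set ℂ) := by
      rcases hu with rfl | rfl <;> simp
    exact hasDerivAt_line hV hG hw (eventually_sub_eq_integral (hint w hw u hu') (hint w hw (-u) hnu'))
  -- the bivariate function `f s t = p (z + s u₁ + t u₂)`
  set A : ℝ × ℝ → ℂ := fun v => z + (v.1 : ℂ) * u₁ + (v.2 : ℂ) * u₂ with hA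
  have hAc : Continuous A :=
    (continuous_const.add ((Complex.continuous_ofReal.comp continuous_fst).mul continuous_const)).add
      ((Complex.continuous_ofReal.comp continuous_snd).mul continuous_const)
  have hA0 : A (0, 0) = z := by simp [hA]
  have hAV : ∀ᶠ v in 𝓝 ((0 : ℝ), (0 : ℝ)), A v ∈ V := by
    refine hAc.continuousAt.preimage_mem_nhds ?_
    rw [hA0]; exact hV.mem_nhds hz
  set f : ℝ → ℝ → ℝ := fun s t => p (A (s, t)) with hf
  set g₁ : ℝ × ℝ → ℝ := fun v => (G (A v) * u₁).re with hg₁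
  set g₂ : ℝ × ℝ → ℝ := fun v => (G (A v) * u₂).re with hg₂
  set f₁ : ℝ → ℝ → ℝ →L[ℝ] ℝ := fun s t => g₁ (s, t) • ContinuousLinearMap.id ℝ ℝ with hf₁
  set f₂ : ℝ → ℝ → ℝ →L[ℝ] ℝ := fun s t => g₂ (s, t) • ContinuousLinearMap.id ℝ ℝ with hf₂
  have hsmul : ∀ c : ℝ, ContinuousLinearMap.toSpanSingleton ℝ c = c • ContinuousLinearMap.id ℝ ℝ := by
    intro c; ext; simp [ContinuousLinearMap.toSpanSingleton_apply]
  have happ : ∀ c x : ℝ, (c • ContinuousLinearMap.id ℝ ℝ) x = c * x := fun c x => by simp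
  -- partial derivatives near `(0,0)`
  have df₁ : ∀ᶠ v in 𝓝 ((0 : ℝ), (0 : ℝ)), HasFDerivAt (f · v.2) (↿f₁ v) v.1 := by
    filter_upwards [hAV] with v hv
    have h := hline (A v) hv u₁ (by simp)
    have hF : HasDerivAt (fun t : ℝ => p (A v + (t : ℂ) * u₁)) ((G (A v) * u₁).re) (v.1 - v.1) := by
      rw [sub_self]; exact h
    have h2 := HasDerivAt.comp_sub_const v.1 v.1 hF
    have heq : (f · v.2) = fun s : ℝ => p (A v + ((s - v.1 : ℝ) : ℂ) * u₁) := by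
      funext s; simp only [hf, hA]; congr 1; push_cast; ring
    rw [heq]
    have h3 := h2.hasFDerivAt
    rw [hsmul] at h3
    exact h3
  have df₂ : ∀ᶠ v in 𝓝 ((0 : ℝ), (0 : ℝ)), HasFDerivAt (f v.1 ·) (↿f₂ v) v.2 := by
    filter_upwards [hAV] with v hv
    have h := hline (A v) hv u₂ (by simp)
    have hF : HasDerivAt (fun t : ℝ => p (A v + (t : ℂ) * u₂)) ((G (A v) * u₂).re) (v.2 - v.2) := by
      rw [sub_self]; exact h
    have h2 := HasDerivAt.comp_sub_const v.2 v.2 hF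
    have heq : (f v.1 ·) = fun t : ℝ => p (A v + ((t - v.2 : ℝ) : ℂ) * u₂) := by
      funext t; simp only [hf, hA]; congr 1; push_cast; ring
    rw [heq]
    have h3 := h2.hasFDerivAt
    rw [hsmul] at h3
    exact h3
  -- continuity of the partial derivatives at `(0,0)`
  have hGA : ContinuousAt (fun v => G (A v)) (0, 0) := by
    have : ContinuousAt G (A (0, 0)) := by rw [hA0]; exact hG.continuousAt (hV.mem_nhds hz)
    exact this.comp hAc.continuousAt
  have cg₁ : ContinuousAt g₁ (0, 0) := Complex.continuous_re.continuousAt.comp (hGA.mul continuousAt_const)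
  have cg₂ : ContinuousAt g₂ (0, 0) := Complex.continuous_re.continuousAt.comp (hGA.mul continuousAt_const)
  have cf₁ : ContinuousAt ↿f₁ (0, 0) := by
    have : ↿f₁ = fun v => g₁ v • ContinuousLinearMap.id ℝ ℝ := by funext v; rfl
    rw [this]; exact cg₁.smul continuousAt_const
  have cf₂ : ContinuousAt ↿f₂ (0, 0) := by
    have : ↿f₂ = fun v => g₂ v • ContinuousLinearMap.id ℝ ℝ := by funext v; rfl
    rw [this]; exact cg₂.smul continuousAt_const
  have hstrict := hasStrictFDerivAt_uncurry_coprod (𝕜 := ℝ) df₁ df₂ cf₁ cf₂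
  have hfd : HasFDerivAt ↿f ((↿f₁ (0, 0)).coprod (↿f₂ (0, 0))) (0, 0) := hstrict.hasFDerivAt
  -- `p = ↿f ∘ (coordinates of · - z)`
  set C : ℂ →L[ℝ] ℝ × ℝ := crossCoords u₁ u₂ with hC
  have hcoord : HasFDerivAt (fun w : ℂ => C (w - z)) C z := by
    have h1 := C.hasFDerivAt.comp z ((hasFDerivAt_id z).sub_const z)
    rw [ContinuousLinearMap.comp_id] at h1
    exact h1
  have hfd' : HasFDerivAt ↿f ((↿f₁ (0, 0)).coprod (↿f₂ (0, 0))) ((fun w : ℂ => C (w - z)) z) := by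
    have : (fun w : ℂ => C (w - z)) z = (0, 0) := by
      show C (z - z) = (0, 0)
      rw [sub_self, map_zero]; rfl
    rw [this]; exact hfd
  have hcomp := HasFDerivAt.comp z hfd' hcoord
  have hpeq : (↿f ∘ fun w : ℂ => C (w - z)) = p := by
    funext w
    have := crossCoords_decomp hind (w - z)
    rw [← hC] at this
    show p (z + (((C (w - z)).1 : ℝ) : ℂ) * u₁ + (((C (w - z)).2 : ℝ) : ℂ) * u₂) = p w
    congr 1
    linear_combination -this
  rw [hpeq] at hcomp
  have hLeq : ((↿f₁ (0, 0)).coprod (↿f₂ (0, 0))).comp C = reMulCLM (G z) := by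
    ext h
    have hdec := crossCoords_decomp hind h
    rw [← hC] at hdec
    rw [ContinuousLinearMap.coe_comp, Function.comp_apply, ContinuousLinearMap.coprod_apply,
      reMulCLM_apply]
    show (g₁ (0, 0) • ContinuousLinearMap.id ℝ ℝ) (C h).1 + (g₂ (0, 0) • ContinuousLinearMap.id ℝ ℝ) (C h).2 =
      (G z * h).re
    rw [happ, happ]
    simp only [hg₁, hg₂, hA0]
    conv_rhs => rw [hdec]
    rw [mul_add, Complex.add_re,
      show G z * (((C h).1 : ℂ) * u₁) = ((C h).1 : ℂ) * (G z * u₁) by ring,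
      show G z * (((C h).2 : ℂ) * u₂) = ((C h).2 : ℂ) * (G z * u₂) by ring,
      Complex.re_ofReal_mul, Complex.re_ofReal_mul]
    ring
  rw [hLeq] at hcomp
  exact hcomp

end Literature.Analysis.Calculus
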